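import Literature.MathematicalPhysics.QuantumFieldTheory.Balaban1983to89.T3Thresholds
import Literature.MathematicalPhysics.QuantumFieldTheory.Balaban1983to89.T3ThresholdSmallness
import HarnessLib

/-!
# Line «sandwich_discharge» on crux `HistoryTailL` (stmt-QuantumFields-19936), stub `stub_sandwichSweepGapCapped` (S′), row (R6) —
# «THE ACTION-SIDE KNIT SOCKET»: from a sweep gain `c·θ(b)(K−j)²∕L^j − E ≤ A(V) − A(Ψ′V)` to the stub's conclusion
# `cg·p(b₀)(g_{K−j})² − D ≤ β_K·(A(V) − A(Ψ′V))`

Cell `ym3-torus` (YM ladder rung R3 = continuum SU(2) Yang–Mills on the three-torus — a RUNG, NOT the Clay problem); width seat `ym3-torus-px8` gen 7;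
`--supports stmt-QuantumFields-19936` (helper).  THEOREMS ONLY (0 `def`, default heartbeats), literature-only imports.

WHY (px8 g7 memo «ARCH-S′ v2 — THE B6 DOOR» (19936 evidence #59) row (R6) KNIT).  The B6 door ends with two lines of pure arithmetic that no file
in the tree states in the stub's letters: (a) the sweep amplitude is optimised — a gain `a·s − B·s² − r` at `s := a∕(2B)` is `a²∕(4B) − r`
(completing the square); (b) the resulting `GAIN ≥ c·θ²∕L^j − E` (`θ := θ(b)(K−j)`) is multiplied by the bare inverse coupling `β_K = (γL^{−K})⁻¹`
and `β_K·θ(b)(K−j)² = L^j·p(b)(g_{K−j})²` EXACTLY (`θ = g·p(g)`, `β_K·g_{K−j}² = L^j`), the profile is monotone in its constant (`p(b₀) ≤ p(b)` for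
`b₀ ≤ b`), so `c·p(b₀)(g_{K−j})² − D ≤ β_K·GAIN` as soon as `β_K·E ≤ D`.  That is LITERALLY the shape of the capped stub's conclusion
`cg * B10.pFun b₀ p₀ (√(γ·(↑F.L)⁻¹^(K−j)))^2 − D ≤ (F.scheme ℰp γ).β K * (wilsonAction4 V − wilsonAction4 (Ψ′ V))` with `A := wilsonAction4 V − wilsonAction4 (Ψ′ V)`.
* §1 `mul_sub_mul_sq_le` (`a·s − B·s² ≤ a²∕(4B)`, `0 < B`), `mul_sub_mul_sq_eq` (equality at `s = a∕(2B)`), `gain_at_opt`;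
* §2 `scheme_β_mul_θBal_sq` (`β_K·θ(b)(K−j)² = L^j·p(b)(g_{K−j})²`; the `β_K·g_{K−j}² = L^j` step is ✓`beta_mul_coupling_sq`, inlined);
* §3 `pFun_le_pFun_of_le_const` (`p` monotone in `b` on `0 < g ≤ 1`);
* §4 ★ `capped_gap_of_gain` — THE SOCKET; ★ `capped_gap_of_sweep` — the same fed by an `a·s − B·s² − r` gain at the optimal amplitude.
HONEST SCOPE: arithmetic of the knit; nothing of B6's rows (R0)–(R5), the capped stub, `HistoryTailL` or any summit statement is proved or claimed;
YM₃ on T³ is rung R3, not d = 4, not Clay. [cite: Balaban1985UV3, (1)-(3) p.256 and (7) p.257]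
-/

noncomputable section

namespace Summit.QuantumFields.YangMills.Theorems.CovariantDischargeKnitSocket

open Literature.MathematicalPhysics.QuantumFieldTheory.Balaban1983to89
open Literature.MathematicalPhysics.QuantumFieldTheory.Balaban1983to89.T3ContinuumYM3Torus
open Literature.MathematicalPhysics.QuantumFieldTheory.Balaban1983to89.T3UnitLawDensityEML (ℰp)
open Literature.MathematicalPhysics.QuantumFieldTheory.Balaban1983to89.T3UnitScaleTilt (θBal)
open Literature.MathematicalPhysics.QuantumFieldTheory.Balaban1983to89.T3Thresholds (θBal_eq coupling_le_one)
open Literature.MathematicalPhysics.QuantumFieldTheory.Balaban1983to89.T3ThresholdSmallness (sqrt_coupling_pos_le)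

/-! ## §1 Completing the square (the optimal sweep amplitude) -/

/-- `a·s − B·s² ≤ a²∕(4B)` for `0 < B` — the sweep gain `a·s − B·s²` (signal minus quadratic cost) is at most its value at `s = a∕(2B)`. [folklore] -/
theorem mul_sub_mul_sq_le (a s : ℝ) {B : ℝ} (hB : 0 < B) : a * s - B * s ^ 2 ≤ a ^ 2 / (4 * B) := by
  have hB0 : B ≠ 0 := hB.ne'
  have key : a * s - B * s ^ 2 = a ^ 2 / (4 * B) - B * (s - a / (2 * B)) ^ 2 := by
    field_simp
    ring
  rw [key]
  nlinarith [sq_nonneg (s - a / (2 * B))]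

/-- Equality at the optimal amplitude `s = a∕(2B)`: `a·s − B·s² = a²∕(4B)`. [folklore] -/
theorem mul_sub_mul_sq_eq (a : ℝ) {B : ℝ} (hB : B ≠ 0) : a * (a / (2 * B)) - B * (a / (2 * B)) ^ 2 = a ^ 2 / (4 * B) := by
  field_simp
  ring

/-- A gain `a·s − B·s² − r ≤ G` at the optimal amplitude `s = a∕(2B)` reads `a²∕(4B) − r ≤ G`. [folklore] -/
theorem gain_at_opt {a B s r G : ℝ} (hB : B ≠ 0) (hs : s = a / (2 * B)) (h : a * s - B * s ^ 2 - r ≤ G) : a ^ 2 / (4 * B) - r ≤ G := by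
  rw [hs, mul_sub_mul_sq_eq a hB] at h
  exact h

/-! ## §2 The bare inverse coupling against the threshold: `β_K·θ(b)(K−j)² = L^j·p(b)(g_{K−j})²` -/

/-- `β_K·θ(b)(K−j)² = L^j·p(b)(g_{K−j})²` — the threshold squared, paid for in units of the bare coupling, is the profile squared times the
block volume factor `L^j` (`θ(i) = g_i·p(g_i)`; the identity `β_K·g_{K−j}² = L^j` is ✓`LocalInsertion.WindowTailOfConcentration.beta_mul_coupling_sq`,
re-derived in two lines as a `have` to keep this file's imports literature-only). [cite: Balaban1985UV3, (3) p.256 and (7) p.257] -/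
theorem scheme_β_mul_θBal_sq (F : T3Family) {γ : ℝ} (hγ : 0 < γ) (b p₀ : ℝ) {K j : ℕ} (hjK : j ≤ K) :
    (F.scheme ℰp γ).β K * θBal F.L γ b p₀ (K - j) ^ 2 =
      (F.L : ℝ) ^ j * B10.pFun b p₀ (Real.sqrt (γ * ((F.L : ℝ)⁻¹) ^ (K - j))) ^ 2 := by
  have hL : (0 : ℝ) < F.L := by exact_mod_cast (lt_trans Nat.zero_lt_one F.hL.2)
  have hβ : (F.scheme ℰp γ).β K = (γ * ((F.L : ℝ)⁻¹) ^ K)⁻¹ := rfl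
  have key : (F.scheme ℰp γ).β K * Real.sqrt (γ * ((F.L : ℝ)⁻¹) ^ (K - j)) ^ 2 = (F.L : ℝ) ^ j := by
    rw [Real.sq_sqrt (by positivity), hβ]
    obtain ⟨i, rfl⟩ := Nat.exists_eq_add_of_le hjK
    rw [Nat.add_sub_cancel_left, pow_add, inv_pow, inv_pow]
    field_simp
  rw [θBal_eq, mul_pow, ← mul_assoc, key]

/-! ## §3 The profile is monotone in its constant -/

/-- `p(b₀)(g) ≤ p(b)(g)` for `b₀ ≤ b` and `0 < g ≤ 1` (`p(b)(g) = b·(1 + log g⁻¹)^{p₀}`, the bracket is `≥ 1`). [cite: Balaban1985UV3, (7) p.257] -/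
theorem pFun_le_pFun_of_le_const {b₀ b p₀ g : ℝ} (hb : b₀ ≤ b) (hg : 0 < g) (hg1 : g ≤ 1) : B10.pFun b₀ p₀ g ≤ B10.pFun b p₀ g := by
  unfold B10.pFun
  have h1 : (0 : ℝ) ≤ 1 + Real.log g⁻¹ := by
    have := Real.log_nonneg (one_le_inv₀ hg |>.mpr hg1)
    linarith
  exact mul_le_mul_of_nonneg_right hb (Real.rpow_nonneg h1 _)

/-! ## §4 ★ The socket -/

/-- ★ **THE ACTION-SIDE KNIT SOCKET.** If the sweep lowers the action by `c·θ(b)(K−j)²∕L^j − E ≤ A` (`A := A(V) − A(Ψ′V)`, `0 ≤ c`) and the remainder is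
affordable in bare units, `β_K·E ≤ D`, then `c·p(b₀)(g_{K−j})² − D ≤ β_K·A` for every `0 ≤ b₀ ≤ b` (`0 < γ ≤ 1`, `j ≤ K`) — LITERALLY the conclusion
shape of `stub_sandwichSweepGapCapped` with `cg := c`. [cite: Balaban1985UV3, (1)-(3) p.256 and (7) p.257] -/
theorem capped_gap_of_gain (F : T3Family) {γ : ℝ} (hγ : 0 < γ) (hγ1 : γ ≤ 1) {b₀ b p₀ : ℝ} (hb₀ : 0 ≤ b₀) (hb : b₀ ≤ b) {K j : ℕ} (hjK : j ≤ K)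
    {c E D A : ℝ} (hc : 0 ≤ c)
    (hgain : c * θBal F.L γ b p₀ (K - j) ^ 2 / (F.L : ℝ) ^ j - E ≤ A)
    (hE : (F.scheme ℰp γ).β K * E ≤ D) :
    c * B10.pFun b₀ p₀ (Real.sqrt (γ * ((F.L : ℝ)⁻¹) ^ (K - j))) ^ 2 - D ≤ (F.scheme ℰp γ).β K * A := by
  have hL1 : 1 ≤ F.L := F.hL.2.le
  have hL : (0 : ℝ) < F.L := by exact_mod_cast (lt_of_lt_of_le Nat.zero_lt_one hL1)
  have hLj : (0 : ℝ) < (F.L : ℝ) ^ j := pow_pos hL j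
  have hβ0 : 0 ≤ (F.scheme ℰp γ).β K := F.scheme_β_nonneg ℰp hγ.le K
  have hg := sqrt_coupling_pos_le hL1 hγ (K - j)
  have hg1 := coupling_le_one hL1 hγ hγ1 (K - j)
  -- multiply the gain by `β_K ≥ 0`
  have h1 : (F.scheme ℰp γ).β K * (c * θBal F.L γ b p₀ (K - j) ^ 2 / (F.L : ℝ) ^ j - E) ≤ (F.scheme ℰp γ).β K * A :=
    mul_le_mul_of_nonneg_left hgain hβ0
  -- rewrite `β_K·θ² ∕ L^j = p(b)²`
  have h2 : (F.scheme ℰp γ).β K * (c * θBal F.L γ b p₀ (K - j) ^ 2 / (F.L : ℝ) ^ j - E) =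
      c * B10.pFun b p₀ (Real.sqrt (γ * ((F.L : ℝ)⁻¹) ^ (K - j))) ^ 2 - (F.scheme ℰp γ).β K * E := by
    have key := scheme_β_mul_θBal_sq F hγ b p₀ hjK
    rw [mul_sub, show (F.scheme ℰp γ).β K * (c * θBal F.L γ b p₀ (K - j) ^ 2 / (F.L : ℝ) ^ j) =
      c * ((F.scheme ℰp γ).β K * θBal F.L γ b p₀ (K - j) ^ 2) / (F.L : ℝ) ^ j by ring, key]
    field_simp
  rw [h2] at h1
  -- monotonicity of the profile in `b` and `β_K·E ≤ D`
  have h3 : B10.pFun b₀ p₀ (Real.sqrt (γ * ((F.L : ℝ)⁻¹) ^ (K - j))) ^ 2 ≤ B10.pFun b p₀ (Real.sqrt (γ * ((F.L : ℝ)⁻¹) ^ (K - j))) ^ 2 := by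
    have hb₀' : B10.pFun b₀ p₀ (Real.sqrt (γ * ((F.L : ℝ)⁻¹) ^ (K - j))) ≤ B10.pFun b p₀ (Real.sqrt (γ * ((F.L : ℝ)⁻¹) ^ (K - j))) :=
      pFun_le_pFun_of_le_const hb hg.1 hg1
    exact pow_le_pow_left₀ (B10.pFun_nonneg b₀ p₀ _ hb₀ hg.1 hg1) hb₀' 2
  nlinarith [mul_le_mul_of_nonneg_left h3 hc, hE]

/-- ★ **THE SOCKET FED BY A SWEEP GAIN AT THE OPTIMAL AMPLITUDE.** If for the amplitude `s = κθ∕(2·B_c·L^j)` (`θ := θ(b)(K−j)`, `0 < B_c`) the sweep gains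
`κθ·s − B_c L^j·s² − r ≤ A` and `β_K·r ≤ D`, then `(κ²∕(4B_c))·p(b₀)(g_{K−j})² − D ≤ β_K·A` (`0 ≤ b₀ ≤ b`, `0 < γ ≤ 1`, `j ≤ K`): the capped stub's
conclusion with `cg := κ²∕(4B_c)`. [cite: Balaban1985UV3, (1)-(3) p.256 and (7) p.257] -/
theorem capped_gap_of_sweep (F : T3Family) {γ : ℝ} (hγ : 0 < γ) (hγ1 : γ ≤ 1) {b₀ b p₀ : ℝ} (hb₀ : 0 ≤ b₀) (hb : b₀ ≤ b) {K j : ℕ} (hjK : j ≤ K)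
    {κ Bc s r D A : ℝ} (hBc : 0 < Bc)
    (hs : s = κ * θBal F.L γ b p₀ (K - j) / (2 * (Bc * (F.L : ℝ) ^ j)))
    (hgain : κ * θBal F.L γ b p₀ (K - j) * s - Bc * (F.L : ℝ) ^ j * s ^ 2 - r ≤ A)
    (hr : (F.scheme ℰp γ).β K * r ≤ D) :
    κ ^ 2 / (4 * Bc) * B10.pFun b₀ p₀ (Real.sqrt (γ * ((F.L : ℝ)⁻¹) ^ (K - j))) ^ 2 - D ≤ (F.scheme ℰp γ).β K * A := by
  have hL : (0 : ℝ) < F.L := by exact_mod_cast (lt_trans Nat.zero_lt_one F.hL.2)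
  have hLj : (0 : ℝ) < (F.L : ℝ) ^ j := pow_pos hL j
  have hB : Bc * (F.L : ℝ) ^ j ≠ 0 := (mul_pos hBc hLj).ne'
  have h1 := gain_at_opt hB hs hgain
  have h2 : (κ * θBal F.L γ b p₀ (K - j)) ^ 2 / (4 * (Bc * (F.L : ℝ) ^ j)) =
      κ ^ 2 / (4 * Bc) * θBal F.L γ b p₀ (K - j) ^ 2 / (F.L : ℝ) ^ j := by
    field_simp
  rw [h2] at h1
  exact capped_gap_of_gain F hγ hγ1 hb₀ hb hjK (by positivity) h1 hr

end Summit.QuantumFields.YangMills.Theorems.CovariantDischargeKnitSocket
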